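import Literature.AlgebraicGeometry.HodgeTheory.WeilFamilyFlatSections
import HarnessLib

/-!
# Deligne's Weil family through an abelian variety of Weil type — EVERY imaginary quadratic field (named fact)

Family `hodge`, layer `Literature/AlgebraicGeometry/HodgeTheory`. ONE named fact, the all-`d` form of the tree's
`deligne1982_weilFamily_hodgeWeilSection` (`WeilFamilyFlatSections.lean`), plus the proved restriction to that fact.

The sibling renders the family of [Deligne1982HodgeCycles, proof of Thm. 4.8 (a)–(c)] (smooth projective family of
Weil-type abelian `2k`-folds through `X`, embedded in `ℙᴺ × S` over a smooth irreducible quasi-projective base,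
a flat Weil section of Hodge type `(k,k)` on every fibre through any non-zero rational `(k,k)` Weil class of `X`,
and a TENSOR POINT `Y ~ A₁ × A₁` with `√-d` acting by the companion matrix of `T² + d`) ONLY for `K = ℚ(√-p)`,
`p` prime, `p ≡ 3 (4)`, `p ≥ 7` — and says why, verbatim, in its docstring: "The hypotheses `p % 4 = 3`, `7 ≤ p`
only fix the sector in which the consuming route states it; the fact holds for every imaginary quadratic field."
Deligne's construction (LNM 900, pp. 47–52) is indeed made for an arbitrary CM field `E` acting on `A` (Thm. 4.8:
"Let `A` be an abelian variety over `ℂ`, and let `E` be a CM-field … such that `H¹(A, ℚ)` is a free `E`-module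
…"); for `E = K = ℚ(√-d)` imaginary quadratic, `d ≥ 1` any positive integer (the order `ℤ[√-d] = ℤ[Φ]` acting
integrally, as in the tree's `weilFamilyReach_hyperbolic`, which is already stated for every `d ≥ 1`), the same
clauses hold word for word: the PEL family of `(X, ℤ[Φ], M)` over a neat-level quotient `Γ\X⁺`
(`Γ ⊂ SU(Λ, H)` torsion free; [MumfordFogartyKirwan1994, Thm. 7.9–7.10]; smooth, connected, quasi-projective,
universal family projective), flat Weil sections of type `(k,k)` on every fibre ("`Γ ⊂ SU`, so `det_E γ = 1`",
p. 50; Prop. 4.4; [vanGeemen1994HodgeAV, 5.8–5.11]), and the tensor / diagonal-CM point in every component,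
`K`-isogenous to `E_K^k ⊗ ℤ[√-d] ≅ E_K^k × E_K^k` with the companion action. PROVENANCE OF THAT POINT (referee
G19 of the packet, precision): Deligne's tensor point `A₀ ⊗ E` (Thm. 4.8 (b)) is built from the SPLIT hypothesis of
4.8 ("(b) there exists a split `E`-Hermitian form", p. 47; p. 52), and [Andre1996Motifs, Lemme 6.3.3] ("Landherr +
puissances d'une courbe elliptique à multiplication complexe") likewise concerns the split case only (André's "de
Weil" includes the condition (*) "un sous-espace totalement isotrope de dimension `½ dim_E V`"); for the NON-split
components the family is van Geemen's [vanGeemen1994HodgeAV, 5.3–5.7] (data `(V, K, H, Λ)`, `H` of signature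
`(k, k)` with `det H = (-1)^k a`, `a ∈ ℚ_{>0}` arbitrary, basis (5.4.1); "any `(X, K, E)` is a member of an `n²`
dimensional family", 5.3), and the diagonal CM point is the member with `V₊ := span(e₁, …, e_k) ⊗ ℝ` for the basis of
(5.4.1) — a `K`-rational positive subspace, so `X_{V₊} ∼ E_K^k(ι) × E_K^k(ῑ)` by 5.7 — a routine step NOT printed
as a numbered statement in any of the three sources (spelled out in the module docstring of
`WeilFamilyFlatSections.lean`).

* `deligne1982_weilFamily_hodgeWeilSection_all` — verbatim `deligne1982_weilFamily_hodgeWeilSection` with the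
  binders `p.Prime → p % 4 = 3 → 7 ≤ p →` replaced by `0 < d →` (all other clauses, including the `(d : ℤ)`-typed
  `Φ ≫ Φ = -((d : ℤ) • 𝟙 X)`, byte-identical in shape).
* `deligne1982_weilFamily_hodgeWeilSection_of_all` (PROVED): the all-`d` fact implies the prime-sector one.

Requested by the B2b ladder `hodge-weil` (prover 2 gen 3, `b2b-hweil-pv2-g3/VARIATIONAL-G3.md` §5b/§6): with it the
summit-side composition `WeilTypeLadder.weilClass_algebraic_of_deligne_of_tensorLocalAnchors` (Deligne's family
THROUGH `X` ∧ locally algebraic tensor anchors ⟹ Weil classes of EVERY `(X, Φ)`, every discriminant) runs for every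
`K`, and the ladder's non-split sixfold rung `NonsplitSixfolds` (all `d`) reduces to local tensor anchors with no
reach fact and no discriminant on the carriers (`Theorems/WeilTypeLadderTensorLocalAnchorAll.lean`).
What is NOT here: anything not in the sibling (no algebraicity at the tensor point, no fixed-part theorem).

## References
* [Deligne1982HodgeCycles] P. Deligne, Hodge cycles on abelian varieties, LNM 900 (1982), Thm. 4.8 and its proof
  (pp. 47–52), Prop. 4.4.
* [vanGeemen1994HodgeAV] B. van Geemen, LNM 1594 (1994), 5.3–5.11.
* [Andre1996Motifs] Y. André, Publ. Math. IHÉS 83 (1996), Lemme 6.3.3.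
* [MumfordFogartyKirwan1994] D. Mumford, J. Fogarty, F. Kirwan, GIT, 3rd ed., Thm. 7.9–7.10.
-/

noncomputable section

open CategoryTheory AlgebraicGeometry Limits MonoidalCategory CartesianMonoidalCategory

namespace Literature.AlgebraicGeometry.HodgeTheory

/-- **Deligne's Weil family with a flat, fibrewise Hodge, Weil section and a tensor-split fibre — every
`K = ℚ(√-d)`, `d ≥ 1`** (NAMED FACT): for `k ≥ 1`, `(X, Φ)` a complex abelian `2k`-fold with `Φ ≫ Φ = -d`, and
`c` a non-zero rational class of Hodge type `(k,k)` in `weilClassesOf X Φ k d`, there are a smooth projective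
family `f : 𝒳 → S` of relative dimension `2k`, embedded in `ℙᴺ × S`, over a smooth irreducible quasi-projective
`ℂ`-scheme, all fibres (isomorphic to) abelian `2k`-folds with an endomorphism of square `-d`, a point `s₁` with
`X ≅ 𝒳_{s₁}`, a CONTINUOUS section `σ` of `FiberClass f (2k)` through `e^{-1*}c`, of Hodge type `(k,k)` on EVERY
fibre, and a point `s₀` whose fibre `Y` carries `Ψ` (`Ψ² = -d`) with an isogeny pair towards the TENSOR POINT
`(A₁ × A₁, (x,y) ↦ (-d·y, x))`, the value `σ(s₀)` lying in `weilClassesOf Y Ψ k d`. Verbatim the sibling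
`deligne1982_weilFamily_hodgeWeilSection` with its route-sector binders `p.Prime → p % 4 = 3 → 7 ≤ p` replaced by
`0 < d` — as that fact's own docstring states, Deligne's construction holds for every imaginary quadratic field
(LNM 900, proof of Thm. 4.8 (a)–(c), made for an arbitrary CM field `E`; the construction of the FAMILY, pp. 47–51,
is discriminant-free; the tensor point of clause (b) is Deligne's/André's for the SPLIT components and van Geemen's
diagonal CM member `V₊ = span(e₁, …, e_k)` of (5.4.1) in general — module docstring). Rendering and design: module
docstring of `WeilFamilyFlatSections.lean`. Users take `(h : deligne1982_weilFamily_hodgeWeilSection_all)`.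
[cite: Deligne1982HodgeCycles, proof of Thm. 4.8 (pp. 47–52), clauses (a)–(c), with Prop. 4.4]
[cite: vanGeemen1994HodgeAV, §5.3–5.11 (the family in every component; diagonal CM point via V₊ = span(e₁..e_k) of (5.4.1))]
[cite: Andre1996Motifs, Lemme 6.3.3 (split components only)] -/
def deligne1982_weilFamily_hodgeWeilSection_all : Prop :=
  ∀ d : ℕ, 0 < d → ∀ (k : ℕ), 1 ≤ k →
    ∀ (X : Motives.AbelianVariety ℂ) (Φ : X ⟶ X), X.dim = 2 * k → Φ ≫ Φ = -((d : ℤ) • 𝟙 X) →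
    ∀ c : complexBetti X.X (2 * k), c ∈ weilClassesOf X Φ k d → c ≠ 0 → IsRationalClass c →
      IsOfHodgeType (2 * k) X.X (2 * k) k k c →
      ∃ (𝒳 S : Motives.SchemeOver ℂ) (f : 𝒳 ⟶ S) (s₁ s₀ : Motives.ComplexPoints S)
        (e : X.X ≅ Motives.fiberOver f s₁) (σ : Motives.ComplexPoints S → FiberClass f (2 * k)),
        Motives.IsSmoothProjectiveFamily f (2 * k) ∧
        (∃ (N : ℕ) (ι : 𝒳 ⟶ Motives.projectiveSpace N ℂ ⊗ S),
            IsClosedImmersion ι.left ∧ ι ≫ snd (Motives.projectiveSpace N ℂ) S = f) ∧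
        IrreducibleSpace S.left ∧ AlgebraicGeometry.Smooth S.hom ∧ IsQuasiProjectiveOver S ∧
        (∀ s : Motives.ComplexPoints S, ∃ (A' : Motives.AbelianVariety ℂ) (φ' : A' ⟶ A'),
          A'.dim = 2 * k ∧ φ' ≫ φ' = -((d : ℤ) • 𝟙 A') ∧ Nonempty (A'.X ≅ Motives.fiberOver f s)) ∧
        Continuous σ ∧ (∀ s, (σ s).pt = s) ∧
        (∀ s, IsOfHodgeType (2 * k) (Motives.fiberOver f (σ s).pt) (2 * k) k k (σ s).cls) ∧
        σ s₁ = ⟨s₁, complexBetti.map e.inv (2 * k) c⟩ ∧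
        ∃ (Y : Motives.AbelianVariety ℂ) (Ψ : Y ⟶ Y) (e₀ : Y.X ≅ Motives.fiberOver f s₀)
          (x : complexBetti (Motives.fiberOver f s₀) (2 * k)),
          (∃ (A₁ : Motives.AbelianVariety ℂ) (f₁ : Y ⟶ A₁.prod A₁) (g₁ : A₁.prod A₁ ⟶ Y) (m : ℕ),
            A₁.dim = k ∧ Y.dim = 2 * k ∧ Ψ ≫ Ψ = -((d : ℤ) • 𝟙 Y) ∧ 0 < m ∧
            f₁ ≫ g₁ = m • 𝟙 Y ∧ Flat f₁.hom.hom.hom.left ∧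
            g₁ ≫ Ψ = Motives.AbelianVariety.prodLift
              (Motives.AbelianVariety.snd A₁ A₁ ≫ (-((d : ℤ) • 𝟙 A₁)))
              (Motives.AbelianVariety.fst A₁ A₁) ≫ g₁) ∧
          σ s₀ = ⟨s₀, x⟩ ∧ complexBetti.map e₀.hom (2 * k) x ∈ weilClassesOf Y Ψ k d

/-- **The all-`d` fact implies the route-sector fact** (`p` prime, `p ≡ 3 (4)`, `p ≥ 7`): restriction of the
binder `d := p` (`0 < p` for a prime). [cite: Deligne1982HodgeCycles, proof of Thm. 4.8 (pp. 47–52)] -/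
theorem deligne1982_weilFamily_hodgeWeilSection_of_all (h : deligne1982_weilFamily_hodgeWeilSection_all) :
    deligne1982_weilFamily_hodgeWeilSection :=
  fun p hp _ _ k hk X Φ hX hΦ c hcW hc0 hcr hcH => h p hp.pos k hk X Φ hX hΦ c hcW hc0 hcr hcH

end Literature.AlgebraicGeometry.HodgeTheory

end
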